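import Literature.NumberTheory.Transcendental.LinGroupZEIdeals
import Literature.NumberTheory.Transcendental.LinGroupZEChain
import Literature.NumberTheory.Transcendental.LinGroupZESubgroupDegrees
import Literature.NumberTheory.Transcendental.PhilipponZeroEstimatePrelim
import Literature.RingTheory.KrullDimension.AffineCatenary
import Literature.NumberTheory.Transcendental.LinGroupZETransversal
import Literature.NumberTheory.Transcendental.LinGroupZEMultiplicity
import Mathlib.RingTheory.Finiteness.Ideal
import HarnessLib

/-!
# Philippon's zero estimate on `𝔾ₐ^{d₀} × 𝔾ₘ^{d₁}` with multiplicities: preliminaries, the descent and the final count (`LinGroup.zeroEstimate`)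

## Philippon's zero estimate on `𝔾ₐ^{d₀} × 𝔾ₘ^{d₁}`: preliminaries for the assembly

Topic `Literature/NumberTheory/Transcendental`. Port to `LinGroup d₀ d₁` (index `Fin d₀ ⊕ Fin d₁`)
of the tree's `PhilipponZeroEstimatePrelim.lean` (the case `d₀ = 1`), for the zero estimate owed
to `Literature.Barriers.Schanuel.roy1992_thm1`: small bridges used by the final assembly of
D. Roy's proof of Thm. 4.1 (Nesterenko–Philippon (eds.), LNM 1752, Ch. 11, pp. 218–220) in the
affine model `G(ℂ) = ℂ^{d₀} × (ℂˣ)^{d₁}` of `LinGroupZEZariski.lean`. PROVED: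

* `pow_subset_sumset` — the pointwise power `Σ^k` lies in Philippon's `Σ(k)` (`LinGroup.sumset`);
* `exists_pow_le_loc_of_mem_minimalPrimes` — for a minimal prime `𝔭` of `I`, `𝔭^M ≤ loc 𝔭 I`
  (prime avoidance among the finitely many minimal primes and `⋂ Min(I) = √I`);
* `le_height_of_dimG_le` — for a prime `𝔭' ∌ u`, `dim_G Z(𝔭') ≤ d ⇒ d₀ + d₁ - d ≤ height 𝔭'`
  (Nullstellensatz in `G` and the dimension formula of affine domains,
  `Literature.RingTheory.KrullDimension.ringKrullDim_quotient_add_height`);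
* `exists_finset_span_eq_of_subset_Box` — a subset of a box piece has a finite subset with the
  same `ℂ`-span;
* (`GaGm.pow_succ_le_factorial_mul_choose` — `(t+1)^m ≤ m!·binom(t+m, m)` — is REUSED from the `d₀ = 1` file.)

Order bookkeeping (`LinGroup.VanishesToOrder.mono`, `LinGroup.vanishesToOrder_one_iff`) lives in
`LinGroup.lean`.

## Philippon's zero estimate on `𝔾ₐ^{d₀} × 𝔾ₘ^{d₁}` with multiplicities: the descent and the primes

Topic `Literature/NumberTheory/Transcendental`. Port to `LinGroup d₀ d₁` (index `Fin d₀ ⊕ Fin d₁`)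
of the tree's `PhilipponZeroEstimateMain.lean` (the case `d₀ = 1`), for the zero estimate owed to
`Literature.Barriers.Schanuel.roy1992_thm1`: D. Roy's proof of Thm. 4.1 (Nesterenko–Philippon
(eds.), LNM 1752, Ch. 11, pp. 218–220) for `G = 𝔾ₐ^{d₀} × 𝔾ₘ^{d₁} ⊂ (ℙ¹)^{d}`, `d = d₀ + d₁`, up
to the two Hilbert-function inequalities at the top components of `Σ + H`. With
`I₁ = (P)^*`, `I_{k+1} = ∂^T_Σ(I_k)` (`LinGroup.royI`, via `LinGroup.dIdeal`) and
`X_k = Z(I_k) ∩ G` (`LinGroup.royX`): the `X_k` decrease, contain `e` for `k ≤ d + 1` (the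
vanishing hypothesis on `Σ(d)` to order `> dT`), `X₁ ≠ G`; two consecutive dimensions agree; a top component `V` of
`X_{r+1}` has `σV ⊆ X_r` (`σ ∈ Σ`); `𝔄 = ∂⁰_V(I_r)` cuts out the transporter `E = {a ; aV ⊆ X_r}`,
the stabiliser `St` of `V` is a closed subgroup with identity component `H₀`
(`LinGroupZESubgroupDegrees`, `LinGroupZESubgroups`), `Σ ⊆ E`, `E` is a finite union of cosets of
`H₀` of dimension `dim H₀`, the cosets `σH₀`, `σ ∈ Σ`, are top components of `E = Z(𝔄)`, their
primes `𝔭_Y` are minimal over `𝔄`, pairwise incomparable, `u ∉ 𝔭_Y`, and `Σ·St ⊆ Z(∂^T 𝔄)`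
(Roy's (d)). PROVED here: `LinGroup.exists_descent_data`, packaging all of this for the final count
(`LinGroupZEMain.lean`).

## Philippon's zero estimate on `𝔾ₐ^{d₀} × 𝔾ₘ^{d₁}` with multiplicities: the final count

Topic `Literature/NumberTheory/Transcendental`. Last module of the port to `LinGroup d₀ d₁` (index
`Fin d₀ ⊕ Fin d₁`, box degrees `deg_{X_i} ≤ D₀`, `deg_{Y_l} ≤ D₁` — the Segre–Veronese embedding of
`(ℙ¹)^{d₀+d₁}`) of the tree's `PhilipponZeroEstimateHolds.lean` (the case `d₀ = 1`,
`Philippon1986_GaGm_holds`), the zero estimate owed to `Literature.Barriers.Schanuel.roy1992_thm1`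
(Roy 1992 Thm 1 = Waldschmidt 1988 Thm 4.1): **`LinGroup.zeroEstimate`**, Philippon's zero
estimate with multiplicities on `𝔾ₐ^{d₀} × 𝔾ₘ^{d₁}` ([Philippon1986, Thm 2.1];
[Waldschmidt1988, Prop. 7.1]) with the constant `c = d!·2^{d²}`, `d = d₀ + d₁`, in EXACTLY the
shape of the hypothesis `hZE` of the tree's assembly
`LinGroup.weakObstruction_of_zeroEstimate_of_auxiliary` (`LinearSubgroupTheoremAssembly.lean`).

It is the end of D. Roy's proof of Thm. 4.1 (LNM 1752, Ch. 11, p. 219, "On the other hand, since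
…"): combining the descent data (`LinGroup.exists_descent_data`) with, at each coset `Y = σH₀`,
`σ ∈ Σ`, a top component of `E = Z(𝔄)`: the multiplicity estimate (`choose_mul_hilbI_le` with
`exists_transversal` and Step 1 `wordDeriv_mem_of_dIdeal_le`) —
`binom(T+s,s)·H_{𝔭_Y}(t) ≤ H_{𝔮_Y}(t + c_Y T)`, `𝔮_Y = loc 𝔭_Y 𝔄`; the sandwich
`H_{𝔭_Y}(t) ≥ mult(Y)·binom(t-a_Y+d', d')`, `mult(Y) = mult(H₀) ≥ D₀^{δ₀}D₁^{δ₁}`; thick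
additivity `∑_Y H_{𝔮_Y}(t-δ) ≤ H_{⋂ 𝔮_Y}(t)`; and the lossy Bézout bound
`H_{⋂ 𝔮_Y}(t) ≤ H_𝔍(t) ≤ 2^{d r} D₀^{d₀}D₁^{d₁} (t+1)^{d'}` for the ideal `𝔍 ≤ ⋂ 𝔮_Y` of a
generic complete intersection of codimension `r = d - d'` through the `Y`'s; comparing leading
coefficients (`GaGm.Asymp.sum_le_of_choose_ineq`) gives
`card(Σ/H₀)·binom(T+s,s)·D₀^{δ₀}D₁^{δ₁} ≤ d!·2^{d²}·D₀^{d₀}D₁^{d₁}`.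

## References

* Yu. V. Nesterenko, P. Philippon (eds.), *Introduction to Algebraic Independence Theory*,
  LNM 1752, Springer 2001, Ch. 11 (D. Roy), §2.2, §4.
* P. Philippon, *Lemmes de zéros dans les groupes algébriques commutatifs*, Bull. Soc. Math.
  France 114 (1986), 355–383, §2, §5.
  LNM 1752, Springer 2001, Ch. 11 (D. Roy), Thm. 4.1 and its proof (pp. 218–220).
  France 114 (1986), 355–383, Thm. 2.1, §5.
  France 114 (1986), 355–383, Théorème 2.1. [Philippon1986]
  LNM 1752, Springer 2001, Ch. 11 (D. Roy), Thm. 4.1. [NesterenkoPhilippon2001]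
* M. Waldschmidt, *On the transcendence methods of Gel'fond and Schneider in several variables*,
  New Advances in Transcendence Theory (1988), 375–398, §7 Proposition 7.1 (p. 390).
  [Waldschmidt1988]
-/
noncomputable section

open MvPolynomial Module
open scoped Pointwise

namespace Literature.NumberTheory.Transcendental

namespace LinGroup

variable {d₀ d₁ : ℕ}

/-! ### Sumsets and pointwise powers -/

/-- `Σ^k ⊆ Σ(k)`: a product of `k` elements of `Σ` lies in Philippon's `Σ(k)`. [folklore] -/
theorem pow_subset_sumset (S : Set (LinGroup d₀ d₁)) : ∀ k : ℕ, S ^ k ⊆ sumset S k := by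
  intro k
  induction k with
  | zero =>
    rw [pow_zero, sumset_zero]
    rfl
  | succ k ih =>
    rw [pow_succ]
    rintro _ ⟨y, hy, s, hs, rfl⟩
    obtain ⟨f, hf, rfl⟩ := ih hy
    refine ⟨Fin.snoc f s, fun i => ?_, ?_⟩
    · refine Fin.lastCases ?_ (fun i' => ?_) i
      · simpa using hs
      · simpa using hf i'
    · rw [Fin.prod_univ_castSucc]
      simp

/-- `Σ(k) ⊆ Σ(k')` for `k ≤ k'` when `e ∈ Σ`. [folklore] -/
theorem sumset_mono {S : Set (LinGroup d₀ d₁)} (h1 : (1 : LinGroup d₀ d₁) ∈ S) {k k' : ℕ} (h : k ≤ k') :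
    sumset S k ⊆ sumset S k' := by
  induction h with
  | refl => exact Set.Subset.rfl
  | step _ ih => exact ih.trans (Descent.sumset_subset_succ h1 _)

/-! ### Minimal primes and components -/

/-- **For a minimal prime `𝔭` of `I`, some power `𝔭^M` lies in the component `loc 𝔭 I`.**
(Take `R ∈ ⋂_{𝔭' ≠ 𝔭 minimal} 𝔭' \ 𝔭`; for `f ∈ 𝔭`, `R f ∈ ⋂ Min(I) = √I`, so `(Rf)^e ∈ I` and
`f^e ∈ loc 𝔭 I`; then `𝔭 ≤ √(loc 𝔭 I)` and `𝔭` is finitely generated.) [folklore] -/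
theorem exists_pow_le_loc_of_mem_minimalPrimes {I 𝔭 : Ideal (MvPolynomial (Fin d₀ ⊕ Fin d₁) ℂ)}
    (h𝔭 : 𝔭 ∈ I.minimalPrimes) : ∃ M : ℕ, 𝔭 ^ M ≤ loc 𝔭 h𝔭.1.1 I := by
  classical
  have h𝔭p : 𝔭.IsPrime := h𝔭.1.1
  set Min := (Ideal.finite_minimalPrimes_of_isNoetherianRing _ I).toFinset with hMin
  have hMinmem : ∀ 𝔭', 𝔭' ∈ Min ↔ 𝔭' ∈ I.minimalPrimes := fun 𝔭' => by rw [hMin, Set.Finite.mem_toFinset]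
  -- elements `b 𝔭' ∈ 𝔭' \ 𝔭` for the other minimal primes
  have hb : ∀ 𝔭' ∈ Min.erase 𝔭, ∃ b : MvPolynomial (Fin d₀ ⊕ Fin d₁) ℂ, b ∈ 𝔭' ∧ b ∉ 𝔭 := by
    intro 𝔭' h𝔭'
    obtain ⟨hne, h𝔭'Min⟩ := Finset.mem_erase.mp h𝔭'
    rw [hMinmem] at h𝔭'Min
    have hnot : ¬ 𝔭' ≤ 𝔭 := fun hle => hne (le_antisymm hle (h𝔭.2 h𝔭'Min.1 hle))
    obtain ⟨b, hb𝔭', hb𝔭⟩ := Set.not_subset.mp hnot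
    exact ⟨b, hb𝔭', hb𝔭⟩
  choose! b hb using hb
  set R := ∏ 𝔭' ∈ Min.erase 𝔭, b 𝔭' with hR
  have hR𝔭 : R ∉ 𝔭 := prod_notMem_of_isPrime h𝔭p _ b fun 𝔭' h𝔭' => (hb 𝔭' h𝔭').2
  have hrad : 𝔭 ≤ (loc 𝔭 h𝔭p I).radical := by
    intro f hf
    -- `R f ∈ ⋂ Min(I) = √I`
    have h1 : R * f ∈ I.radical := by
      rw [← Ideal.sInf_minimalPrimes]
      refine Submodule.mem_sInf.mpr fun 𝔭' h𝔭' => ?_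
      by_cases heq : 𝔭' = 𝔭
      · rw [heq]; exact 𝔭.mul_mem_left R hf
      · have hmem : 𝔭' ∈ Min.erase 𝔭 := Finset.mem_erase.mpr ⟨heq, (hMinmem 𝔭').mpr h𝔭'⟩
        refine Ideal.mul_mem_right _ _ ?_
        rw [hR, ← Finset.mul_prod_erase _ _ hmem]
        exact Ideal.mul_mem_right _ _ (hb 𝔭' hmem).1
    obtain ⟨e, he⟩ := h1
    exact ⟨e, pow_mem_loc h𝔭p hR𝔭 he⟩
  exact Ideal.exists_pow_le_of_le_radical_of_fg hrad (IsNoetherian.noetherian 𝔭)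

/-! ### Heights of primes with small zero set -/

/-- **Dimension bound to height bound**: for a prime `𝔭' ∌ u` of `B = ℂ[X, Y]` whose
zero set in `G` has dimension `≤ d`, `d₀ + d₁ - d ≤ height 𝔭'` (Nullstellensatz in `G`:
`𝔍(Z(𝔭')) = 𝔭'`; dimension formula `dim B/𝔭' + height 𝔭' = d₀ + d₁`). [folklore] -/
theorem le_height_of_dimG_le {𝔭' : Ideal (MvPolynomial (Fin d₀ ⊕ Fin d₁) ℂ)} (h𝔭' : 𝔭'.IsPrime)
    (hu : torusUnit d₀ d₁ ∉ 𝔭') {d : ℕ} (hdim : dimG (zeroSet (d₀ := d₀) (d₁ := d₁) (𝔭' : Set (MvPolynomial (Fin d₀ ⊕ Fin d₁) ℂ))) ≤ d) :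
    ((d₀ + d₁ - d : ℕ) : ℕ∞) ≤ 𝔭'.height := by
  haveI := h𝔭'
  have hv := vanishing_zeroSet_eq_of_isPrime h𝔭' hu
  have hne : (zeroSet (d₀ := d₀) (d₁ := d₁) (𝔭' : Set (MvPolynomial (Fin d₀ ⊕ Fin d₁) ℂ))).Nonempty := by
    by_contra h
    rw [Set.not_nonempty_iff_eq_empty] at h
    rw [h, vanishing_empty] at hv
    exact h𝔭'.ne_top hv.symm
  have hdimG := dimG_eq hne
  rw [hv] at hdimG
  have hformula := Literature.RingTheory.KrullDimension.ringKrullDim_quotient_add_height ℂ 𝔭'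
  rw [ringKrullDim_poly, ← hdimG] at hformula
  -- finite height
  have hfin : 𝔭'.height ≠ ⊤ := by
    have h1 := Ideal.height_le_ringKrullDim_of_ne_top h𝔭'.ne_top
    rw [ringKrullDim_poly] at h1
    intro htop
    rw [htop] at h1
    have h2 : (⊤ : ℕ∞) ≤ ((d₀ + d₁ : ℕ) : ℕ∞) := by exact_mod_cast h1
    exact absurd h2 (not_le.mpr (ENat.coe_lt_top (d₀ + d₁)))
  obtain ⟨h, hh⟩ := ENat.ne_top_iff_exists.mp hfin
  rw [← hh] at hformula ⊢
  have e : ((dimG (zeroSet (d₀ := d₀) (d₁ := d₁) (𝔭' : Set (MvPolynomial (Fin d₀ ⊕ Fin d₁) ℂ))) : WithBot ℕ∞) + ((h : ℕ∞) : WithBot ℕ∞)) =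
      ((dimG (zeroSet (d₀ := d₀) (d₁ := d₁) (𝔭' : Set (MvPolynomial (Fin d₀ ⊕ Fin d₁) ℂ))) + h : ℕ) : WithBot ℕ∞) := by
    push_cast; rfl
  rw [e] at hformula
  have h2 : dimG (zeroSet (d₀ := d₀) (d₁ := d₁) (𝔭' : Set (MvPolynomial (Fin d₀ ⊕ Fin d₁) ℂ))) + h = d₀ + d₁ := by exact_mod_cast hformula
  exact_mod_cast (show d₀ + d₁ - d ≤ h by omega)

/-! ### Finite generating sets inside a box -/

/-- A subset of a box piece has a finite subset with the same `ℂ`-span. [folklore] -/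
theorem exists_finset_span_eq_of_subset_Box {D₀ D₁ t : ℕ} {F : Set (MvPolynomial (Fin d₀ ⊕ Fin d₁) ℂ)}
    (hF : F ⊆ (Box (d₀ := d₀) (d₁ := d₁) D₀ D₁ t : Set (MvPolynomial (Fin d₀ ⊕ Fin d₁) ℂ))) :
    ∃ Fs : Finset (MvPolynomial (Fin d₀ ⊕ Fin d₁) ℂ), (↑Fs : Set (MvPolynomial (Fin d₀ ⊕ Fin d₁) ℂ)) ⊆ F ∧
      Submodule.span ℂ F = Submodule.span ℂ (↑Fs : Set (MvPolynomial (Fin d₀ ⊕ Fin d₁) ℂ)) := by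
  have hle : Submodule.span ℂ F ≤ Box (d₀ := d₀) (d₁ := d₁) D₀ D₁ t := Submodule.span_le.mpr hF
  haveI : FiniteDimensional ℂ ↥(Submodule.span ℂ F) := Submodule.finiteDimensional_of_le hle
  have hfg : (Submodule.span ℂ F).FG := (Submodule.fg_iff_finiteDimensional _).mpr inferInstance
  exact (Submodule.fg_span_iff_fg_span_finset_subset F).mp hfg

end LinGroup

end Literature.NumberTheory.Transcendental

noncomputable section

open MvPolynomial Module
open scoped Pointwise

namespace Literature.NumberTheory.Transcendental

namespace LinGroup

variable {d₀ d₁ : ℕ}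

section Descent

variable (W : Submodule ℂ ((Fin d₀ → ℂ) × (Fin d₁ → ℂ))) (S : Set (LinGroup d₀ d₁)) (T : ℕ) (P : MvPolynomial (Fin d₀ ⊕ Fin d₁) ℂ)

/-- Roy's ideals `I₁ = (P)^*`, `I_{k+1} = ∂^T_Σ(I_k)` (indexed from `0`: `royI 0 = (P)^*`).
[cite: NesterenkoPhilippon2001, Ch. 11 Thm. 4.1 (proof)] -/
def royI (k : ℕ) : Ideal (MvPolynomial (Fin d₀ ⊕ Fin d₁) ℂ) :=
  (dIdeal W S T)^[k] (sat (Ideal.span {P}))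

/-- Roy's closed sets `X_k = Z(I_k) ∩ G` (indexed from `0`). [cite: NesterenkoPhilippon2001, Ch. 11 Thm. 4.1 (proof)] -/
def royX (k : ℕ) : Set (LinGroup d₀ d₁) := zeroSet (d₀ := d₀) (d₁ := d₁) (royI W S T P k : Set (MvPolynomial (Fin d₀ ⊕ Fin d₁) ℂ))

/-- `I_{k+1} = ∂^{kT}_{Σ(k)}(P)` (Prop. 3.6 (ii)). [folklore] -/
theorem royI_eq (k : ℕ) : royI W S T P k = dIdeal W (S ^ k) (k * T) (Ideal.span {P}) :=
  dIdeal_iterate S T _ k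

/-- The recursion. [folklore] -/
theorem royI_succ (k : ℕ) : royI W S T P (k + 1) = dIdeal W S T (royI W S T P k) := by
  rw [royI, Function.iterate_succ_apply']; rfl

/-- `X_0 = Z(P)`. [folklore] -/
theorem royX_zero : royX W S T P 0 = zeroSet (d₀ := d₀) (d₁ := d₁) {P} := by
  rw [royX, royI, Function.iterate_zero, id_eq, zeroSet_sat, zeroSet_span]

/-- The `X_k` are closed. [folklore] -/
theorem isClosedG_royX (k : ℕ) : IsClosedG (royX W S T P k) := isClosedG_zeroSet _

variable {W S T P}

/-- The `X_k` decrease (`I_k ⊆ I_{k+1}` as `e ∈ Σ`). [folklore] -/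
theorem royX_succ_subset (h1 : (1 : LinGroup d₀ d₁) ∈ S) (k : ℕ) : royX W S T P (k + 1) ⊆ royX W S T P k := by
  rw [royX, royX, royI_succ]
  exact zeroSet_antitone (le_dIdeal h1 T _)

/-- The `X_k` decrease. [folklore] -/
theorem royX_antitone (h1 : (1 : LinGroup d₀ d₁) ∈ S) {k k' : ℕ} (h : k ≤ k') : royX W S T P k' ⊆ royX W S T P k := by
  induction h with
  | refl => exact Set.Subset.rfl
  | step _ ih => exact (royX_succ_subset h1 _).trans ih

/-- **`e ∈ X_k` for `k ≤ d = d₀ + d₁`** from the vanishing of `P` to order `> dT` on `Σ(d)`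
(Prop. 3.6 (iii)). [cite: NesterenkoPhilippon2001, Ch. 11 Thm. 4.1 (proof)] -/
theorem one_mem_royX (h1 : (1 : LinGroup d₀ d₁) ∈ S)
    (hvan : ∀ g ∈ sumset S (d₀ + d₁), VanishesToOrder P W g ((d₀ + d₁) * T + 1)) {k : ℕ} (hk : k ≤ d₀ + d₁) :
    (1 : LinGroup d₀ d₁) ∈ royX W S T P k := by
  rw [royX, royI_eq, zeroSet_dIdeal]
  intro P' hP' σ hσ
  obtain ⟨Q, rfl⟩ := Ideal.mem_span_singleton'.mp hP'
  rw [mul_one]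
  have hσ' : σ ∈ sumset S (d₀ + d₁) := sumset_mono h1 hk (pow_subset_sumset S k hσ)
  exact ((hvan σ hσ').mono (by nlinarith)).mul_left Q

/-- `X_0 ≠ G` as `P ≠ 0`. [folklore] -/
theorem royX_zero_ne_univ (hP0 : P ≠ 0) : royX W S T P 0 ≠ Set.univ := by
  intro h
  apply hP0
  have : P ∈ vanishing (Set.univ : Set (LinGroup d₀ d₁)) := fun g _ => by
    have hg : g ∈ royX W S T P 0 := h ▸ Set.mem_univ g
    rw [royX_zero] at hg
    exact hg P rfl
  rwa [vanishing_univ, Submodule.mem_bot] at this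

/-- **`σ X_{k+1} ⊆ X_k` for `σ ∈ Σ`**: the points of `X_{k+1}` are zeros of
`∂^T_Σ(I_k) ⊇ ∂⁰_Σ(I_k)`. [cite: NesterenkoPhilippon2001, Ch. 11 Thm. 4.1 (proof)] -/
theorem mul_mem_royX {σ v : LinGroup d₀ d₁} (hσ : σ ∈ S) {k : ℕ} (hv : v ∈ royX W S T P (k + 1)) :
    σ * v ∈ royX W S T P k := by
  rw [royX, royI_succ] at hv
  have hv' : v ∈ zeroSet (d₀ := d₀) (d₁ := d₁) (dIdeal W S 0 (royI W S T P k) : Set (MvPolynomial (Fin d₀ ⊕ Fin d₁) ℂ)) :=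
    zeroSet_antitone (dIdeal_mono Set.Subset.rfl (Nat.zero_le T) le_rfl) hv
  rw [zeroSet_dIdeal] at hv'
  intro P' hP'
  exact (vanishesToOrder_one_iff P' W (σ * v)).mp (hv' P' hP' σ hσ)

/-- The transporter of `V` into `Z(J)`: `Z(∂⁰_V(J)) = {a ; aV ⊆ Z(J)}`. [folklore] -/
theorem mem_zeroSet_dIdeal_zero_iff (V : Set (LinGroup d₀ d₁)) (J : Ideal (MvPolynomial (Fin d₀ ⊕ Fin d₁) ℂ)) (a : LinGroup d₀ d₁) :
    a ∈ zeroSet (d₀ := d₀) (d₁ := d₁) (dIdeal W V 0 J : Set (MvPolynomial (Fin d₀ ⊕ Fin d₁) ℂ)) ↔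
      a • V ⊆ zeroSet (d₀ := d₀) (d₁ := d₁) (J : Set (MvPolynomial (Fin d₀ ⊕ Fin d₁) ℂ)) := by
  rw [zeroSet_dIdeal]
  simp only [Set.mem_setOf_eq, zero_add, vanishesToOrder_one_iff]
  constructor
  · rintro h _ ⟨v, hv, rfl⟩ P' hP'
    dsimp only
    rw [smul_eq_mul, mul_comm]
    exact h P' hP' v hv
  · intro h P' hP' v hv
    rw [mul_comm]
    exact h ⟨v, hv, rfl⟩ P' hP'

end Descent

/-! ### The descent data -/

/-- **The descent of Roy's proof of Thm. 4.1, packaged.** From the data of the zero estimate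
(with `P ∈ Box(1)`) we obtain: an irreducible closed subgroup `H₀`, a special
ideal `𝔄` generated (up to saturation) by box polynomials `Fgen ⊆ Box(1)` with zero set `E`, such
that `Σ ⊆ E`, every coset `σH₀` (`σ ∈ Σ`) lies in `E`, is a top-dimensional component of `E`
(`dim E = dim H₀`), and lies in `Z(∂^T_{e} 𝔄)`; and a point `v₀` with `P(v₀ h) = 0` for `h ∈ H₀`.
[cite: NesterenkoPhilippon2001, Ch. 11 Thm. 4.1 (proof, steps a–e)] -/
theorem exists_descent_data {D₀ D₁ : ℕ} (W : Submodule ℂ ((Fin d₀ → ℂ) × (Fin d₁ → ℂ))) {S : Set (LinGroup d₀ d₁)}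
    (h1 : (1 : LinGroup d₀ d₁) ∈ S) (T : ℕ) {P : MvPolynomial (Fin d₀ ⊕ Fin d₁) ℂ} (hP0 : P ≠ 0)
    (hPB : P ∈ Box (d₀ := d₀) (d₁ := d₁) D₀ D₁ 1)
    (hvan : ∀ g ∈ sumset S (d₀ + d₁), VanishesToOrder P W g ((d₀ + d₁) * T + 1)) :
    ∃ (H₀ : Subgroup (LinGroup d₀ d₁)) (_ : IsIrred (H₀ : Set (LinGroup d₀ d₁)))
      (Fgen : Set (MvPolynomial (Fin d₀ ⊕ Fin d₁) ℂ)) (v₀ : LinGroup d₀ d₁),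
      Fgen ⊆ (Box (d₀ := d₀) (d₁ := d₁) D₀ D₁ 1 : Set (MvPolynomial (Fin d₀ ⊕ Fin d₁) ℂ)) ∧
      (∀ h ∈ H₀, evalAt P (v₀ * h) = 0) ∧
      let 𝔄 := sat (Ideal.span Fgen)
      let E := zeroSet (d₀ := d₀) (d₁ := d₁) (𝔄 : Set (MvPolynomial (Fin d₀ ⊕ Fin d₁) ℂ))
      S ⊆ E ∧
      (∀ σ ∈ S, σ • (H₀ : Set (LinGroup d₀ d₁)) ⊆ E) ∧
      (∀ σ ∈ S, dimG (σ • (H₀ : Set (LinGroup d₀ d₁))) = dimG E) ∧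
      (∀ σ ∈ S, σ • (H₀ : Set (LinGroup d₀ d₁)) ⊆
        zeroSet (d₀ := d₀) (d₁ := d₁) (dIdeal W {(1 : LinGroup d₀ d₁)} T 𝔄 : Set (MvPolynomial (Fin d₀ ⊕ Fin d₁) ℂ))) ∧
      dimG E ≤ d₀ + d₁ - 1 := by
  classical
  -- the chain `X_k`
  have hXcl : ∀ k, IsClosedG (royX W S T P k) := isClosedG_royX W S T P
  have h1X : ∀ k, k ≤ d₀ + d₁ → (1 : LinGroup d₀ d₁) ∈ royX W S T P k := fun k hk => one_mem_royX h1 hvan hk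
  have hXne : ∀ k, k ≤ d₀ + d₁ → (royX W S T P k).Nonempty := fun k hk => ⟨1, h1X k hk⟩
  -- `dim X_0 ≤ d₀ + d₁ - 1`
  have hd0 : dimG (royX W S T P 0) ≤ d₀ + d₁ - 1 ∧ 1 ≤ d₀ + d₁ := by
    have hlt := dimG_lt_of_ssubset isIrred_univ (hXcl 0) (hXne 0 (Nat.zero_le _))
      (Set.ssubset_univ_iff.mpr (royX_zero_ne_univ hP0))
    rw [dimG_univ] at hlt
    omega
  obtain ⟨hd0, hpos⟩ := hd0
  -- pigeonhole
  obtain ⟨r, hrn, hdr⟩ := GaGm.Descent.exists_eq_succ_of_antitone (d := fun k => dimG (royX W S T P k))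
    (fun k => dimG_mono (royX_succ_subset h1 k)) hd0
  -- a top-dimensional component `V` of `X_{r+1}`
  obtain ⟨𝔮ᵥ, h𝔮ᵥ, hdimV⟩ := exists_minimalPrimes_dimG_eq (hXne (r + 1) (by omega))
  obtain ⟨hV, -, hVsub⟩ := isIrred_zeroSet_of_mem_minimalPrimes h𝔮ᵥ
  rw [(hXcl (r + 1)).eq] at hVsub
  generalize hVgen : zeroSet (d₀ := d₀) (d₁ := d₁) (↑𝔮ᵥ : Set (MvPolynomial (Fin d₀ ⊕ Fin d₁) ℂ)) = V at hV hVsub hdimV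
  -- the stabiliser and its identity component
  have hStcl : IsClosedG ((MulAction.stabilizer (LinGroup d₀ d₁) V : Subgroup (LinGroup d₀ d₁)) : Set (LinGroup d₀ d₁)) :=
    Descent.isClosedG_stabilizer hV
  have hG'irr : IsIrred ((idComp (MulAction.stabilizer (LinGroup d₀ d₁) V) hStcl : Subgroup (LinGroup d₀ d₁)) : Set (LinGroup d₀ d₁)) :=
    isIrred_idComp _ hStcl
  have hG'St : idComp (MulAction.stabilizer (LinGroup d₀ d₁) V) hStcl ≤ MulAction.stabilizer (LinGroup d₀ d₁) V := idComp_le _ hStcl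
  obtain ⟨Tf, -, hStT⟩ := exists_finset_eq_biUnion_smul_idComp (MulAction.stabilizer (LinGroup d₀ d₁) V) hStcl
  generalize hG'gen : idComp (MulAction.stabilizer (LinGroup d₀ d₁) V) hStcl = G' at hG'irr hG'St hStT
  -- generators: `I_r = (G₀)^*`, `𝔄 = ∂⁰_V(I_r) = (Fgen)^*`
  set G₀ : Set (MvPolynomial (Fin d₀ ⊕ Fin d₁) ℂ) := dGens W (S ^ r) (r * T) {P} with hG₀
  set Fgen : Set (MvPolynomial (Fin d₀ ⊕ Fin d₁) ℂ) := dGens W V 0 G₀ with hFgen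
  have hG₀B : G₀ ⊆ (Box (d₀ := d₀) (d₁ := d₁) D₀ D₁ 1 : Set (MvPolynomial (Fin d₀ ⊕ Fin d₁) ℂ)) :=
    dGens_subset_Box (by simpa using hPB)
  have hFgenB : Fgen ⊆ (Box (d₀ := d₀) (d₁ := d₁) D₀ D₁ 1 : Set (MvPolynomial (Fin d₀ ⊕ Fin d₁) ℂ)) := dGens_subset_Box hG₀B
  have hIr : royI W S T P r = sat (Ideal.span G₀) := by rw [royI_eq, dIdeal_span]
  have h𝔄eq : dIdeal W V 0 (royI W S T P r) = sat (Ideal.span Fgen) := by rw [hIr, dIdeal_sat_span]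
  set 𝔄 := sat (Ideal.span Fgen) with h𝔄
  set E := zeroSet (d₀ := d₀) (d₁ := d₁) (𝔄 : Set (MvPolynomial (Fin d₀ ⊕ Fin d₁) ℂ)) with hE
  -- the transporter
  have hmemE : ∀ a, a ∈ E ↔ a • V ⊆ royX W S T P r := fun a => by
    rw [hE, ← h𝔄eq, mem_zeroSet_dIdeal_zero_iff]; rfl
  have hEcl : IsClosedG E := isClosedG_zeroSet _
  have hSE : S ⊆ E := fun σ hσ => (hmemE σ).mpr (by
    rintro _ ⟨v, hv, rfl⟩
    exact mul_mem_royX hσ (hVsub hv))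
  have h1E : (1 : LinGroup d₀ d₁) ∈ E := hSE h1
  have hESt : ∀ g ∈ E, ∀ s ∈ MulAction.stabilizer (LinGroup d₀ d₁) V, g * s ∈ E := fun g hg s hs => by
    rw [hmemE, mul_smul, MulAction.mem_stabilizer_iff.mp hs]
    exact (hmemE g).mp hg
  have hcosE : ∀ g ∈ E, g • ((G' : Subgroup (LinGroup d₀ d₁)) : Set (LinGroup d₀ d₁)) ⊆ E := by
    rintro g hg _ ⟨h, hh, rfl⟩
    exact hESt g hg h (hG'St hh)
  -- `E`-translates of `V` are top-dimensional components of `X_r`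
  have htrans : ∀ c ∈ E, ∃ 𝔮 ∈ (vanishing (royX W S T P r)).minimalPrimes,
      c • V = zeroSet (d₀ := d₀) (d₁ := d₁) ↑𝔮 := fun c hc =>
    (hV.smul c).exists_eq_zeroSet_minimalPrimes (hXcl r) ((hmemE c).mp hc)
      (by rw [dimG_smul, hdimV]; exact hdr.symm)
  -- finitely many `St`-cosets cover `E`
  have hcover : ∃ C : Finset (LinGroup d₀ d₁),
      E ⊆ ⋃ c ∈ C, c • ((MulAction.stabilizer (LinGroup d₀ d₁) V : Subgroup (LinGroup d₀ d₁)) : Set (LinGroup d₀ d₁)) := by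
    have hpick : ∀ 𝔮 : Ideal (MvPolynomial (Fin d₀ ⊕ Fin d₁) ℂ), ∃ c : LinGroup d₀ d₁,
        (∃ c' ∈ E, c' • V = zeroSet (d₀ := d₀) (d₁ := d₁) ↑𝔮) → c • V = zeroSet (d₀ := d₀) (d₁ := d₁) ↑𝔮 := by
      intro 𝔮
      by_cases h : ∃ c' ∈ E, c' • V = zeroSet (d₀ := d₀) (d₁ := d₁) ↑𝔮
      · obtain ⟨c', -, h'⟩ := h; exact ⟨c', fun _ => h'⟩
      · exact ⟨1, fun h' => absurd h' h⟩
    choose pick hpick using hpick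
    refine ⟨(comps (royX W S T P r)).image pick, fun c hc => ?_⟩
    obtain ⟨𝔮, h𝔮, hc𝔮⟩ := htrans c hc
    have hp := hpick 𝔮 ⟨c, hc, hc𝔮⟩
    rw [Set.mem_iUnion₂]
    refine ⟨pick 𝔮, Finset.mem_image_of_mem _ (mem_comps.mpr h𝔮), (pick 𝔮)⁻¹ * c, ?_, by simp [smul_eq_mul]⟩
    have : ((pick 𝔮)⁻¹ * c) • V = V := by rw [mul_smul, hc𝔮, ← hp, inv_smul_smul]
    exact MulAction.mem_stabilizer_iff.mpr this
  obtain ⟨C, hEC⟩ := hcover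
  -- `dim E ≤ dim G'`
  have hdimE : dimG E ≤ dimG ((G' : Subgroup (LinGroup d₀ d₁)) : Set (LinGroup d₀ d₁)) := by
    obtain ⟨𝔯, h𝔯, hdim𝔯⟩ := exists_minimalPrimes_dimG_eq (X := E) ⟨1, h1E⟩
    obtain ⟨h𝔯irr, -, h𝔯sub⟩ := isIrred_zeroSet_of_mem_minimalPrimes h𝔯
    rw [hEcl.eq] at h𝔯sub
    have hsub : zeroSet (d₀ := d₀) (d₁ := d₁) ↑𝔯 ⊆
        ⋃ p ∈ C ×ˢ Tf, (p.1 * p.2) • ((G' : Subgroup (LinGroup d₀ d₁)) : Set (LinGroup d₀ d₁)) := by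
      intro g hg
      obtain ⟨c, hc, hgc⟩ := Set.mem_iUnion₂.mp (hEC (h𝔯sub hg))
      obtain ⟨s, hs, rfl⟩ := hgc
      have hsSt : s ∈ ((MulAction.stabilizer (LinGroup d₀ d₁) V : Subgroup (LinGroup d₀ d₁)) : Set (LinGroup d₀ d₁)) := hs
      rw [hStT] at hsSt
      obtain ⟨a, ha, hsa⟩ := Set.mem_iUnion₂.mp hsSt
      obtain ⟨g', hg', rfl⟩ := hsa
      rw [Set.mem_iUnion₂]
      exact ⟨(c, a), Finset.mem_product.mpr ⟨hc, ha⟩, g', hg', by simp [smul_eq_mul, mul_assoc]⟩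
    obtain ⟨p, -, hp⟩ := h𝔯irr.exists_subset_of_subset_biUnion (C ×ˢ Tf) _
      (fun p _ => (hG'irr.isClosedG).smul _) hsub
    rw [← hdim𝔯]
    exact (dimG_mono hp).trans (dimG_smul _ _).le
  -- Roy's (d): `Σ·St ⊆ Z(∂^T 𝔄)`
  have hdT : ∀ σ ∈ S, ∀ s ∈ MulAction.stabilizer (LinGroup d₀ d₁) V,
      σ * s ∈ zeroSet (d₀ := d₀) (d₁ := d₁) (dIdeal W {(1 : LinGroup d₀ d₁)} T 𝔄 : Set (MvPolynomial (Fin d₀ ⊕ Fin d₁) ℂ)) := by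
    intro σ hσ s hs
    -- `s ∈ F = Z(∂⁰_V(I_{r+1}))` since `sV = V ⊆ X_{r+1}`
    have hsF : s ∈ zeroSet (d₀ := d₀) (d₁ := d₁) (dIdeal W V 0 (royI W S T P (r + 1)) : Set (MvPolynomial (Fin d₀ ⊕ Fin d₁) ℂ)) := by
      rw [mem_zeroSet_dIdeal_zero_iff, MulAction.mem_stabilizer_iff.mp hs]
      exact hVsub
    -- `∂⁰_V(I_{r+1}) = ∂^T_Σ(𝔄) = ∂⁰_Σ(∂^T 𝔄)`
    have hideal : dIdeal W V 0 (royI W S T P (r + 1)) = dIdeal W S 0 (dIdeal W {(1 : LinGroup d₀ d₁)} T 𝔄) := by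
      rw [royI_succ, dIdeal_dIdeal, dIdeal_dIdeal, Set.singleton_one, mul_one, zero_add, ← h𝔄eq, dIdeal_dIdeal,
        add_zero, mul_comm V S]
    rw [hideal, zeroSet_dIdeal] at hsF
    intro P' hP'
    exact (vanishesToOrder_one_iff P' W (σ * s)).mp (hsF P' hP' σ hσ)
  -- a point of `V`
  obtain ⟨v₀, hv₀⟩ := hV.nonempty
  refine ⟨G', hG'irr, Fgen, v₀, hFgenB, fun h hh => ?_, hSE, fun σ hσ => hcosE σ (hSE hσ), fun σ hσ => ?_,
    fun σ hσ => ?_, ?_⟩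
  · -- `v₀ h ∈ V ⊆ X_{r+1} ⊆ X_0 = Z(P)`
    have hhSt : h • V = V := MulAction.mem_stabilizer_iff.mp (hG'St hh)
    have hmem : v₀ * h ∈ V := by rw [mul_comm, ← hhSt]; exact Set.smul_mem_smul_set hv₀
    have h0 := royX_antitone h1 (Nat.zero_le (r + 1)) (hVsub hmem)
    rw [royX_zero] at h0
    exact h0 P rfl
  · exact le_antisymm (dimG_mono (hcosE σ (hSE hσ))) (hdimE.trans (dimG_smul σ _).symm.le)
  · rintro _ ⟨h, hh, rfl⟩
    exact hdT σ hσ h (hG'St hh)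
  · -- `dim E ≤ dim G' ≤ dim St ≤ d₀ + d₁ - 1` since `St ≠ G` (else `V = G`, `X_0 = G`)
    show dimG E ≤ d₀ + d₁ - 1
    have hStne : ((MulAction.stabilizer (LinGroup d₀ d₁) V : Subgroup (LinGroup d₀ d₁)) : Set (LinGroup d₀ d₁)) ≠ Set.univ := by
      intro huniv
      apply royX_zero_ne_univ (W := W) (S := S) (T := T) hP0
      refine Set.eq_univ_of_forall fun g => royX_antitone h1 (Nat.zero_le (r + 1)) (hVsub ?_)
      have hg : g * v₀⁻¹ ∈ ((MulAction.stabilizer (LinGroup d₀ d₁) V : Subgroup (LinGroup d₀ d₁)) : Set (LinGroup d₀ d₁)) :=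
        huniv ▸ Set.mem_univ _
      have hst : (g * v₀⁻¹) • V = V := MulAction.mem_stabilizer_iff.mp hg
      have : (g * v₀⁻¹) * v₀ ∈ V := by rw [← hst]; exact Set.smul_mem_smul_set hv₀
      simpa using this
    have hlt := dimG_lt_of_ssubset isIrred_univ hStcl ⟨1, (MulAction.stabilizer (LinGroup d₀ d₁) V).one_mem⟩
      (Set.ssubset_univ_iff.mpr hStne)
    rw [dimG_univ] at hlt
    have hG'le : dimG ((G' : Subgroup (LinGroup d₀ d₁)) : Set (LinGroup d₀ d₁)) ≤
        dimG ((MulAction.stabilizer (LinGroup d₀ d₁) V : Subgroup (LinGroup d₀ d₁)) : Set (LinGroup d₀ d₁)) := dimG_mono hG'St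
    omega

end LinGroup

end Literature.NumberTheory.Transcendental

noncomputable section

open MvPolynomial Module
open scoped Pointwise

namespace Literature.NumberTheory.Transcendental

namespace LinGroup

variable {d₀ d₁ : ℕ}

/-- A partial `X`-degree is at most the total `X`-degree. [folklore] -/
theorem degreeOf_inl_le_degX (P : MvPolynomial (Fin d₀ ⊕ Fin d₁) ℂ) (i : Fin d₀) :
    P.degreeOf (Sum.inl i) ≤ degX P := by
  classical
  rw [degreeOf_le_iff]
  intro s hs
  exact (Finset.single_le_sum (fun i _ => Nat.zero_le (s (Sum.inl i))) (Finset.mem_univ i)).trans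
    ((degX_le_iff (D := degX P)).mp le_rfl s hs)

/-- A partial `Y`-degree is at most the total `Y`-degree. [folklore] -/
theorem degreeOf_inr_le_degY (P : MvPolynomial (Fin d₀ ⊕ Fin d₁) ℂ) (l : Fin d₁) :
    P.degreeOf (Sum.inr l) ≤ degY P := by
  classical
  rw [degreeOf_le_iff]
  intro s hs
  exact (Finset.single_le_sum (fun l _ => Nat.zero_le (s (Sum.inr l))) (Finset.mem_univ l)).trans
    ((degY_le_iff (D := degY P)).mp le_rfl s hs)

/-- Polynomials of `X`-degree `≤ D₀` and `Y`-degree `≤ D₁` are box polynomials of box degrees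
`(D₀, D₁)`. [folklore] -/
theorem mem_Box_one_of_degX_degY {D₀ D₁ : ℕ} {P : MvPolynomial (Fin d₀ ⊕ Fin d₁) ℂ} (h0 : degX P ≤ D₀)
    (h1 : degY P ≤ D₁) : P ∈ Box (d₀ := d₀) (d₁ := d₁) D₀ D₁ 1 := by
  rw [mem_Box_iff', one_mul, one_mul]
  exact ⟨fun i => (degreeOf_inl_le_degX P i).trans h0, fun l => (degreeOf_inr_le_degY P l).trans h1⟩

variable (d₀ d₁) in
/-- **Philippon's zero estimate with multiplicities on `𝔾ₐ^{d₀} × 𝔾ₘ^{d₁}`** (Philippon 1986,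
Thm. 2.1, special case `K = ℂ`, `G = 𝔾ₐ^{d₀} × 𝔾ₘ^{d₁} ⊂ (ℙ¹)^{d₀+d₁}`; Roy, LNM 1752 Ch. 11
Thm. 4.1; quoted as [Waldschmidt1988, Prop. 7.1]). There is a constant `c` (namely
`d!·2^{d²}`, `d = d₀ + d₁`) such that: for integers `D₀, D₁ ≥ 1`, `T ≥ 0`, a subspace `W ≠ 0` of
`Lie G = ℂ^{d₀} × ℂ^{d₁}`, a finite `Σ ⊂ G(ℂ)` containing `e`, and a nonzero `P ∈ ℂ[X, Y]` with
total `X`-degree `≤ D₀` and total `Y`-degree `≤ D₁` vanishing to order `≥ dT + 1` along `exp_G(W)`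
at every point of `Σ(d)`, there is a connected algebraic subgroup `G' = E × T'` of `G`, contained
in a translate of the zero set of `P` (hence `G' ≠ G`), with
`binom(T + s, s) · card((Σ·G')/G') · D₀^{dim E} · D₁^{dim T'} ≤ c · D₀^{d₀} · D₁^{d₁}`,
`s = dim W - dim (W ∩ Lie G')` — the printed inequality
`binom(T + codim_A(A∩G'), codim) · card((Σ+G')/G') · H(G'; D₀, D₁) ≤ H(G; c₁D₀, c₂D₁)` read through
`H(G'; D₀, D₁) ≥ D₀^{dim E} D₁^{dim T'}` (`LinGroup.pow_le_mult`). This is verbatim the hypothesis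
`hZE` of `LinGroup.weakObstruction_of_zeroEstimate_of_auxiliary`.
[cite: Philippon1986, Thm 2.1] [cite: Waldschmidt1988, §7 Proposition 7.1 (p. 390)] -/
theorem zeroEstimate : ∃ c : ℕ, ∀ (D₀ D₁ T : ℕ) (W : Submodule ℂ ((Fin d₀ → ℂ) × (Fin d₁ → ℂ)))
      (S : Set (LinGroup d₀ d₁)) (P : MvPolynomial (Fin d₀ ⊕ Fin d₁) ℂ),
    1 ≤ D₀ → 1 ≤ D₁ → 0 < finrank ℂ W → S.Finite → (1 : LinGroup d₀ d₁) ∈ S → P ≠ 0 →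
    degX P ≤ D₀ → degY P ≤ D₁ →
    (∀ g ∈ sumset S (d₀ + d₁), VanishesToOrder P W g ((d₀ + d₁) * T + 1)) →
    ∃ H : ConnAlgSubgroup d₀ d₁,
      (∃ g : LinGroup d₀ d₁, ∀ h ∈ H.toSubgroup, evalAt P (g * h) = 0) ∧
      Nat.choose (T + (finrank ℂ W - finrank ℂ ↥(W ⊓ H.tangent)))
          (finrank ℂ W - finrank ℂ ↥(W ⊓ H.tangent)) *
        Set.ncard ((QuotientGroup.mk : LinGroup d₀ d₁ → LinGroup d₀ d₁ ⧸ H.toSubgroup) '' S) *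
        D₀ ^ H.addDim * D₁ ^ H.torusDim ≤ c * D₀ ^ d₀ * D₁ ^ d₁ := by
  refine ⟨(d₀ + d₁).factorial * 2 ^ ((d₀ + d₁) * (d₀ + d₁)), ?_⟩
  intro D₀ D₁ T W S P hD₀ hD₁ _hW hS h1 hP0 hdeg0 hdeg1 hvan
  classical
  -- `P ∈ Box(1)`
  have hPB : P ∈ Box (d₀ := d₀) (d₁ := d₁) D₀ D₁ 1 := mem_Box_one_of_degX_degY hdeg0 hdeg1
  -- the descent
  obtain ⟨H₀, hirr, Fgen, v₀, hFgenB, hv₀, hSE, hcosE, hdimcos, hdT, hdimEn⟩ :=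
    exists_descent_data W h1 T hP0 hPB hvan
  set 𝔄 : Ideal (MvPolynomial (Fin d₀ ⊕ Fin d₁) ℂ) := sat (Ideal.span Fgen) with h𝔄
  set E : Set (LinGroup d₀ d₁) := zeroSet (d₀ := d₀) (d₁ := d₁) (𝔄 : Set (MvPolynomial (Fin d₀ ⊕ Fin d₁) ℂ)) with hE
  set K := toConnAlgSubgroup H₀ hirr with hK
  have hKH : K.toSubgroup = H₀ := toSubgroup_toConnAlgSubgroup H₀ hirr
  refine ⟨K, ⟨v₀, fun h hh => hv₀ h (by rw [hKH] at hh; exact hh)⟩, ?_⟩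
  set s := finrank ℂ W - finrank ℂ ↥(W ⊓ K.tangent) with hs
  set d' := dimG E with hd'
  have hEcl : IsClosedG E := isClosedG_zeroSet _
  have hEeq : E = zeroSet (d₀ := d₀) (d₁ := d₁) Fgen := by rw [hE, h𝔄, zeroSet_sat, zeroSet_span]
  have hvanE : vanishing E = 𝔄.radical := by rw [hEeq, ← zeroSet_span, h𝔄, radical_sat]
  have h𝔄E : (𝔄 : Set (MvPolynomial (Fin d₀ ⊕ Fin d₁) ℂ)) ⊆ vanishing E := subset_vanishing_zeroSet _
  -- the cosets `Y = σ H₀`, `σ ∈ Σ`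
  set 𝓨 : Finset (Set (LinGroup d₀ d₁)) := hS.toFinset.image fun σ => σ • (H₀ : Set (LinGroup d₀ d₁)) with h𝓨
  have hYrep : ∀ Y ∈ 𝓨, ∃ σ ∈ S, Y = σ • (H₀ : Set (LinGroup d₀ d₁)) := fun Y hY => by
    obtain ⟨σ, hσ, rfl⟩ := Finset.mem_image.mp hY
    exact ⟨σ, hS.mem_toFinset.mp hσ, rfl⟩
  choose! rep hrepS hrepY using hYrep
  have h1𝓨 : (1 : LinGroup d₀ d₁) • (H₀ : Set (LinGroup d₀ d₁)) ∈ 𝓨 := Finset.mem_image.mpr ⟨1, hS.mem_toFinset.mpr h1, rfl⟩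
  haveI : Nonempty ↥𝓨 := ⟨⟨_, h1𝓨⟩⟩
  -- properties of a coset
  have hYirr : ∀ Y : ↥𝓨, IsIrred (Y : Set (LinGroup d₀ d₁)) := fun Y => by
    rw [hrepY Y Y.2]; exact hirr.smul _
  have hYE : ∀ Y : ↥𝓨, (Y : Set (LinGroup d₀ d₁)) ⊆ E := fun Y => by
    rw [hrepY Y Y.2]; exact hcosE _ (hrepS Y Y.2)
  have hYdim : ∀ Y : ↥𝓨, dimG (Y : Set (LinGroup d₀ d₁)) = d' := fun Y => by
    rw [hrepY Y Y.2]; exact hdimcos _ (hrepS Y Y.2)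
  have hYdT : ∀ Y : ↥𝓨, (Y : Set (LinGroup d₀ d₁)) ⊆
      zeroSet (d₀ := d₀) (d₁ := d₁) (dIdeal W {(1 : LinGroup d₀ d₁)} T 𝔄 : Set (MvPolynomial (Fin d₀ ⊕ Fin d₁) ℂ)) := fun Y => by
    rw [hrepY Y Y.2]; exact hdT _ (hrepS Y Y.2)
  -- the primes
  set 𝔭 : ↥𝓨 → Ideal (MvPolynomial (Fin d₀ ⊕ Fin d₁) ℂ) := fun Y => vanishing (Y : Set (LinGroup d₀ d₁)) with h𝔭
  have h𝔭p : ∀ Y, (𝔭 Y).IsPrime := fun Y => (hYirr Y).2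
  have h𝔄le : ∀ Y, 𝔄 ≤ 𝔭 Y := fun Y => fun f hf => vanishing_antitone (hYE Y) (h𝔄E hf)
  have hu : ∀ Y, torusUnit d₀ d₁ ∉ 𝔭 Y := fun Y hmem => by
    obtain ⟨y, hy⟩ := (hYirr Y).nonempty
    exact evalAt_torusUnit_ne_zero y (hmem y hy)
  have hmin : ∀ Y, 𝔭 Y ∈ 𝔄.minimalPrimes := fun Y => by
    obtain ⟨𝔮, h𝔮, hYeq⟩ := (hYirr Y).exists_eq_zeroSet_minimalPrimes hEcl (hYE Y) (hYdim Y)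
    have h := (isIrred_zeroSet_of_mem_minimalPrimes h𝔮).2.1
    rw [← hYeq] at h
    rw [← Ideal.radical_minimalPrimes, ← hvanE, show 𝔭 Y = 𝔮 from h]
    exact h𝔮
  have hrad : ∀ Y, ∃ M : ℕ, 𝔭 Y ^ M ≤ loc (𝔭 Y) (h𝔭p Y) 𝔄 := fun Y =>
    exists_pow_le_loc_of_mem_minimalPrimes (hmin Y)
  have hinc : ∀ Y Y' : ↥𝓨, 𝔭 Y ≤ 𝔭 Y' → Y = Y' := fun Y Y' hle => by
    have hsub : (Y' : Set (LinGroup d₀ d₁)) ⊆ Y := by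
      rw [← (hYirr Y').isClosedG.eq, ← (hYirr Y).isClosedG.eq]
      exact zeroSet_antitone hle
    have heq := (hYirr Y).eq_of_subset_of_dimG_eq (hYirr Y').isClosedG (hYirr Y').nonempty hsub
      (by rw [hYdim, hYdim])
    exact Subtype.ext heq.symm
  -- the components and the multiplicity estimate at each coset
  have hcount : ∀ Y : ↥𝓨, ∃ cY : ℕ, ∀ t,
      (T + s).choose s * hilbI (d₀ := d₀) (d₁ := d₁) D₀ D₁ ((𝔭 Y).restrictScalars ℂ) t ≤
        hilbI D₀ D₁ ((loc (𝔭 Y) (h𝔭p Y) 𝔄).restrictScalars ℂ) (t + cY * T) := fun Y => by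
    have hdTle : dIdeal W {(1 : LinGroup d₀ d₁)} T 𝔄 ≤ 𝔭 Y := fun f hf =>
      vanishing_antitone (hYdT Y) (subset_vanishing_zeroSet _ hf)
    have h𝔄w := wordDeriv_mem_of_dIdeal_le (W := W) hdTle
    obtain ⟨cY, w, g, hwW, hg𝔭, hgB, hoff, hdiag⟩ := exists_transversal H₀ hirr (rep Y) hD₀ hD₁ W
    have hpY : vanishing ((rep Y) • (H₀ : Set (LinGroup d₀ d₁))) = 𝔭 Y := by rw [h𝔭]; simp only; rw [← hrepY Y Y.2]
    rw [hpY] at hg𝔭 hoff hdiag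
    exact ⟨cY, fun t => choose_mul_hilbI_le (h𝔭p Y) hg𝔭 hoff hdiag (opPow_mem_of_mem_loc (h𝔭p Y) h𝔄w hwW) hgB t⟩
  choose cY hcY using hcount
  -- the sandwich of each coset
  have hmultY : ∀ Y : ↥𝓨, mult D₀ D₁ (Y : Set (LinGroup d₀ d₁)) = mult D₀ D₁ (H₀ : Set (LinGroup d₀ d₁)) := fun Y => by
    rw [hrepY Y Y.2]; exact mult_smul hD₀ hD₁ hirr _
  have hsand : ∀ Y : ↥𝓨, ∃ a : ℕ, ∀ t, a ≤ t →
      mult D₀ D₁ (H₀ : Set (LinGroup d₀ d₁)) * (t - a + d').choose d' ≤ hilbI (d₀ := d₀) (d₁ := d₁) D₀ D₁ ((𝔭 Y).restrictScalars ℂ) t := by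
    intro Y
    obtain ⟨a, γ, h⟩ := ((hYirr Y).hasMult hD₀ hD₁).1
    refine ⟨a, fun t ht => ?_⟩
    have := (h t ht).1
    rwa [hYdim, hmultY] at this
  choose aY haY using hsand
  -- thick additivity
  obtain ⟨δ, hδ⟩ := exists_sum_hilbI_loc_le hD₀ hD₁ 𝔄 𝔭 h𝔭p hinc h𝔄le hrad Finset.univ
  -- the lossy Bézout bound
  obtain ⟨Fs, hFsF, hspanFs⟩ := exists_finset_span_eq_of_subset_Box hFgenB
  have hFgen𝔄 : Fgen ⊆ (𝔄 : Set (MvPolynomial (Fin d₀ ⊕ Fin d₁) ℂ)) := fun f hf =>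
    le_sat _ (Ideal.subset_span hf)
  have hspanFs𝔄 : Ideal.span (↑Fs : Set (MvPolynomial (Fin d₀ ⊕ Fin d₁) ℂ)) ≤ 𝔄 :=
    Ideal.span_le.mpr (hFsF.trans hFgen𝔄)
  set r' := d₀ + d₁ - d' with hr'
  have hr'le : r' ≤ d₀ + d₁ := Nat.sub_le _ _
  have hd'le : d' ≤ d₀ + d₁ := by have := hdimEn; omega
  have hDH : ∀ 𝔭' : Ideal (MvPolynomial (Fin d₀ ⊕ Fin d₁) ℂ), 𝔭'.IsPrime → (∃ Y, 𝔭' ≤ 𝔭 Y) →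
      (↑Fs : Set (MvPolynomial (Fin d₀ ⊕ Fin d₁) ℂ)) ⊆ 𝔭' → (r' : ℕ∞) ≤ 𝔭'.height := by
    rintro 𝔭' h𝔭' ⟨Y, hle⟩ hFs
    have hu' : torusUnit d₀ d₁ ∉ 𝔭' := fun h => hu Y (hle h)
    refine le_height_of_dimG_le h𝔭' hu' ((dimG_mono ?_).trans (le_of_eq rfl))
    -- `Z(𝔭') ⊆ Z(Fgen) = E`
    rw [hEeq]
    intro g hg f hf
    have hfspan : f ∈ Submodule.span ℂ (↑Fs : Set (MvPolynomial (Fin d₀ ⊕ Fin d₁) ℂ)) := by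
      rw [← hspanFs]; exact Submodule.subset_span hf
    have hf𝔭' : f ∈ 𝔭' := (Submodule.span_le.mpr hFs : Submodule.span ℂ (↑Fs : Set _) ≤ 𝔭'.restrictScalars ℂ) hfspan
    exact hg f hf𝔭'
  obtain ⟨𝔍, h𝔍le, h𝔍bd⟩ := exists_ideal_hilbI_le 𝔭 h𝔭p Fs r' hDH hD₀ hD₁ hr'le
    (hFsF.trans hFgenB) (fun Y => hFsF.trans (hFgen𝔄.trans (h𝔄le Y)))
  have h𝔍𝔮 : 𝔍 ≤ Finset.univ.inf fun Y => loc (𝔭 Y) (h𝔭p Y) 𝔄 :=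
    Finset.le_inf fun Y _ => (h𝔍le Y).trans (loc_mono (h𝔭p Y) hspanFs𝔄)
  -- the comparison of leading coefficients
  set Kb := 2 ^ ((d₀ + d₁) * r') * (D₀ ^ d₀ * D₁ ^ d₁) with hKb
  have hmain : ∀ t, δ + Finset.univ.sup (fun Y => cY Y * T + aY Y) ≤ t →
      ∑ Y ∈ (Finset.univ : Finset ↥𝓨), ((T + s).choose s * mult D₀ D₁ (H₀ : Set (LinGroup d₀ d₁))) *
          (t - (δ + cY Y * T + aY Y) + d').choose d' ≤ (Kb * d'.factorial) * (t + 0 + d').choose d' := by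
    intro t ht
    have hY : ∀ Y : ↥𝓨, cY Y * T + aY Y ≤ Finset.univ.sup (fun Y => cY Y * T + aY Y) := fun Y =>
      Finset.le_sup (f := fun Y => cY Y * T + aY Y) (Finset.mem_univ Y)
    calc ∑ Y ∈ (Finset.univ : Finset ↥𝓨), ((T + s).choose s * mult D₀ D₁ (H₀ : Set (LinGroup d₀ d₁))) *
          (t - (δ + cY Y * T + aY Y) + d').choose d'
        ≤ ∑ Y ∈ (Finset.univ : Finset ↥𝓨), hilbI (d₀ := d₀) (d₁ := d₁) D₀ D₁ ((loc (𝔭 Y) (h𝔭p Y) 𝔄).restrictScalars ℂ) (t - δ) := by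
          refine Finset.sum_le_sum fun Y _ => ?_
          have h1 := haY Y (t - δ - cY Y * T) (by have := hY Y; omega)
          have h2 := hcY Y (t - δ - cY Y * T)
          have e1 : t - δ - cY Y * T - aY Y = t - (δ + cY Y * T + aY Y) := by omega
          have e2 : t - δ - cY Y * T + cY Y * T = t - δ := by have := hY Y; omega
          rw [e1] at h1
          rw [e2] at h2
          calc (T + s).choose s * mult D₀ D₁ (H₀ : Set (LinGroup d₀ d₁)) * (t - (δ + cY Y * T + aY Y) + d').choose d'
              = (T + s).choose s * (mult D₀ D₁ (H₀ : Set (LinGroup d₀ d₁)) * (t - (δ + cY Y * T + aY Y) + d').choose d') := by ring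
            _ ≤ (T + s).choose s * hilbI (d₀ := d₀) (d₁ := d₁) D₀ D₁ ((𝔭 Y).restrictScalars ℂ) (t - δ - cY Y * T) :=
                Nat.mul_le_mul_left _ h1
            _ ≤ _ := h2
      _ ≤ hilbI D₀ D₁ ((Finset.univ.inf fun Y => loc (𝔭 Y) (h𝔭p Y) 𝔄).restrictScalars ℂ) t := hδ t (by omega)
      _ ≤ hilbI D₀ D₁ (𝔍.restrictScalars ℂ) t := hilbI_antitone (fun x hx => h𝔍𝔮 hx) t
      _ ≤ Kb * (t + 1) ^ (d₀ + d₁ - r') := h𝔍bd t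
      _ = Kb * (t + 1) ^ d' := by rw [show d₀ + d₁ - r' = d' by omega]
      _ ≤ Kb * (d'.factorial * (t + d').choose d') := Nat.mul_le_mul_left _ (GaGm.pow_succ_le_factorial_mul_choose t d')
      _ = (Kb * d'.factorial) * (t + 0 + d').choose d' := by rw [Nat.add_zero]; ring
  have hsum := GaGm.Asymp.sum_le_of_choose_ineq (Finset.univ : Finset ↥𝓨) (Kb * d'.factorial)
    (fun _ => (T + s).choose s * mult D₀ D₁ (H₀ : Set (LinGroup d₀ d₁))) (fun Y => δ + cY Y * T + aY Y) 0 d' _ hmain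
  rw [Finset.sum_const, smul_eq_mul, Finset.card_univ, Fintype.card_coe] at hsum
  -- counting the cosets
  have hfib : ∀ x ∈ S, ∀ y ∈ S, (QuotientGroup.mk x : LinGroup d₀ d₁ ⧸ K.toSubgroup) = QuotientGroup.mk y ↔
      x • (H₀ : Set (LinGroup d₀ d₁)) = y • (H₀ : Set (LinGroup d₀ d₁)) := by
    intro x _ y _
    rw [QuotientGroup.eq, ← hKH, leftCoset_eq_iff]
  have hncard : Set.ncard ((QuotientGroup.mk : LinGroup d₀ d₁ → LinGroup d₀ d₁ ⧸ K.toSubgroup) '' S) = 𝓨.card := by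
    rw [GaGm.Descent.ncard_image_eq_of_fibres hS _ (fun σ => σ • (H₀ : Set (LinGroup d₀ d₁))) hfib,
      show (fun σ => σ • (H₀ : Set (LinGroup d₀ d₁))) '' S = ↑𝓨 by rw [h𝓨, Finset.coe_image, hS.coe_toFinset],
      Set.ncard_coe_finset]
  -- the multiplicity of `H₀`
  have hmult := pow_le_mult hD₀ hD₁ H₀ hirr
  rw [← hK] at hmult
  -- the constant
  have hconst : Kb * d'.factorial ≤ (d₀ + d₁).factorial * 2 ^ ((d₀ + d₁) * (d₀ + d₁)) * D₀ ^ d₀ * D₁ ^ d₁ := by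
    have h1 : d'.factorial ≤ (d₀ + d₁).factorial := Nat.factorial_le hd'le
    have h2 : 2 ^ ((d₀ + d₁) * r') ≤ 2 ^ ((d₀ + d₁) * (d₀ + d₁)) :=
      Nat.pow_le_pow_right (by norm_num) (Nat.mul_le_mul_left _ hr'le)
    calc Kb * d'.factorial = 2 ^ ((d₀ + d₁) * r') * d'.factorial * (D₀ ^ d₀ * D₁ ^ d₁) := by rw [hKb]; ring
      _ ≤ 2 ^ ((d₀ + d₁) * (d₀ + d₁)) * (d₀ + d₁).factorial * (D₀ ^ d₀ * D₁ ^ d₁) :=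
          Nat.mul_le_mul_right _ (Nat.mul_le_mul h2 h1)
      _ = (d₀ + d₁).factorial * 2 ^ ((d₀ + d₁) * (d₀ + d₁)) * D₀ ^ d₀ * D₁ ^ d₁ := by ring
  -- assemble
  rw [hncard]
  calc (T + s).choose s * 𝓨.card * D₀ ^ K.addDim * D₁ ^ K.torusDim
      = (T + s).choose s * (D₀ ^ K.addDim * D₁ ^ K.torusDim) * 𝓨.card := by ring
    _ ≤ (T + s).choose s * mult D₀ D₁ (H₀ : Set (LinGroup d₀ d₁)) * 𝓨.card :=
        Nat.mul_le_mul_right _ (Nat.mul_le_mul_left _ hmult)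
    _ = 𝓨.card * ((T + s).choose s * mult D₀ D₁ (H₀ : Set (LinGroup d₀ d₁))) := by ring
    _ ≤ Kb * d'.factorial := hsum
    _ ≤ _ := hconst

end LinGroup

end Literature.NumberTheory.Transcendental
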